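import Literature.Computability.Complexity.ExponentialTime
import Literature.Computability.FineGrained.SATBruteForceMachine
import HarnessLib

/-!
# P vs NP family: discharge of `eth_iff_satExponent_three_pos'` (**pnp.S34**, `ETH ↔ s₃ > 0`)

Companion to `ExponentialTime.lean`. The named fact
`Literature.Computability.Complexity.eth_iff_satExponent_three_pos'` is, by definition,
`FineGrained.ETH ↔ 0 < FineGrained.satExponent 3`, i.e. literally the `fine-grained` family's
named fact `FineGrained.eth_iff_satExponent_pos` (**fine-grained.S02** in printed form), which is
discharged in `Literature/Computability/FineGrained/SATBruteForceMachine.lean`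
(`FineGrained.eth_iff_satExponent_pos_holds`: the set `{δ ≥ 0 : 3-SAT ∈ TIME(2^{δ n} · poly(L))}`
defining `s₃` is nonempty — it contains `1` by the brute-force decider, `kSATInExpTime_one_holds` —
and upward closed, so `(∃ δ > 0, 3-SAT ∉ TIME(2^{δ n} · poly(L))) ↔ 0 < s₃`; the order-theoretic
glue is `FineGrained.eth_iff_satExponent_pos_of_kSATInExpTime_one` in `FineGrainedWave0Proofs.lean`).
This file only re-exports that discharge under the `pnp` name; it is kept separate from the
statement file so that `ExponentialTime.lean` does not import the machine constructions.

## References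

* R. Impagliazzo, R. Paturi, *On the complexity of k-SAT*, JCSS 62 (2001) 367–375,
  doi:10.1006/jcss.2000.1727, §1, p. 368: definition of `s_k`, of ETH, and Theorem 1 ((1) ETH ⇔
  (3) `s_3 > 0`). [ImpagliazzoPaturiJCSS2001]
* C. Calabro, R. Impagliazzo, R. Paturi, *The complexity of satisfiability of small depth
  circuits*, IWPEC 2009, LNCS 5917, §1.1 (held copy, PDF p. 3): "Let ETH denote the
  Exponential-Time Hypothesis: `s_3 > 0`." [CalabroImpagliazzoPaturiIWPEC2009]
-/

namespace Literature.Computability.Complexity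

/-- **Discharge of `eth_iff_satExponent_three_pos'`** (**pnp.S34**, ETH in its printed form
`ETH ↔ s₃ > 0`, `s₃ = FineGrained.satExponent 3 = inf {δ ≥ 0 : 3-SAT ∈ TIME(2^{δ n} · poly(L))}`):
the fact is definitionally `FineGrained.eth_iff_satExponent_pos`, discharged by
`FineGrained.eth_iff_satExponent_pos_holds` (brute force puts `1` in the set defining `s₃`, which
is upward closed). (Impagliazzo–Paturi, JCSS 62 (2001), p. 368: definition of `s_k` and of ETH,
Theorem 1 (1)⇔(3); Calabro–Impagliazzo–Paturi, IWPEC 2009, §1.1: "Let ETH denote the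
Exponential-Time Hypothesis: `s_3 > 0`".)
[cite: ImpagliazzoPaturiJCSS2001, p. 368 (definition of s_k; Theorem 1 (1)⇔(3))] -/
theorem eth_iff_satExponent_three_pos'_holds : eth_iff_satExponent_three_pos' :=
  FineGrained.eth_iff_satExponent_pos_holds

end Literature.Computability.Complexity
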